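import Mathlib
import HarnessLib
import Summits.NavierStokesRegularity.NavierStokesRegularity.Theorems.TaylorModelRungThreeReadoutVTube
import Summits.NavierStokesRegularity.NavierStokesRegularity.Theorems.TaylorModelRungThreeReadoutFlowPackageVDirectional
import Summits.NavierStokesRegularity.NavierStokesRegularity.Theorems.TaylorModelRungThreeReadoutFlowVDeriv

/-!
# Line `taylor-model` on crux K1b-DR (stmt-NavierStokesRegularity-23954) — G3-v part 2: SEGMENT DERIVATIVES along
# κ-restart chains (K1b-DR's flow-Lipschitz clause `|∂_σ φ(z′+σ(z−z′)) i k (t′)| ≤ Λ·d·ω_k`)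

Continuation of `…ReadoutVTube`.  For two restarts `z, z′` that are `κ_j·ω`-close to the polytope trajectory
`φ j q` at time `t` and `d·ω`-close to each other, the segment `σ ↦ z_σ := z′ + σ(z − z′)` consists of restarts
(`inBall_segment`), so part 1 carries every `z_σ` to the end of the stage through the outer hulls.  Here the
DIRECTION `∂_σ` is transported: on the first partial sub-step by (F4′) (`≤ L1_a·d·ω`); node to node by the chain
rule with the sub-step derivative of (F9) (`exists_fderiv_directional_of_core`), whose KERNEL lies in
`[Mlo, Mhi]` by its column Taylor models and clause (M) — so the node directions are again a chain of real kernels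
applied to the entry direction and (R2) bounds them by `G·L1_a·d`; inside the final sub-step by (F9)'s DIRECTIONAL
property (`∈ r·[loV, hiV]`, rows `≤ L1_b·ω`); (R3) turns `L1_a·G·L1_b` (and `L1_a` alone) into `Λ_j`.

* `exists_stepKer_of_core` — (F9) at `u = h`: ONE derivative `L` of the sub-step flow at an outer-hull start with a
  KERNEL `K ∈ [Mlo, Mhi]` representing it on the window (`(L v)_(i′,k′) = kapp K (ofVec v) i′ k′`);
* `restart_dirNodes` — the node induction for directions; `restart_segDeriv` — K1b-DR's clause for every
  `t′ ∈ [0, Tn S − t]`;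
* `kBlockTubeLip_ofV` — K1b-DR's blocks `KBlockTube ∧ KBlockLip` for the v3 certificate, given the G1-v node
  invariant of the polytope trajectories and `0 ≤ τ ≤ Tn S` (G2-v).

MODEL-lattice rung TL-M3 only; nothing here is a statement about the Navier–Stokes equations.
-/

noncomputable section

-- the sub-problem namespace repeats the summit name by design (D-0017)
set_option linter.dupNamespace false

namespace Summit.NavierStokesRegularity.NavierStokesRegularity.Theorems.TaylorModelV

open Set Finset
open Literature.Analysis.FluidPDE.TaoCascade Literature.Analysis.FluidPDE.TaoCascade.TaylorChain
open Summit.NavierStokesRegularity.NavierStokesRegularity.Theorems.TaylorModelMajorant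
open Summit.NavierStokesRegularity.NavierStokesRegularity.Theorems.TaylorModelVector
open Summit.NavierStokesRegularity.NavierStokesRegularity.Theorems.TaylorModelReadout

variable {cd : CertData} {bx : StepBoxes} {rd : RadiiData} {ro : ReadoutData} {φ : Flow}

/-! ### The one-step kernel of (F9) -/

/-- **One-step kernel of (F9).** At an outer-hull start `z` of sub-step `(j,s)`: ONE derivative `L` of the window
flow over the sub-step, DIRECTIONAL (`|v|_c ≤ r·ω_c ⇒ L v ∈ r·[loV, hiV]`), together with a real KERNEL
`K ∈ [Mlo s, Mhi s]` that represents it on the window: `(L v) (eW (i′,k′)) = kapp K (ofVec v) i′ k′`. [folklore] -/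
theorem exists_stepKer_of_core (hSN : cd.StageNumerics) (hC : ChainVCore cd bx) {j : ℕ} (hj : j ≤ cd.N₀)
    {s : ℕ} (hs : s < cd.S j) {z : Fin 4 → ℤ → ℝ} (hz : InBox cd (bx.hlo 2 j s) (bx.hhi 2 j s) z) :
    ∃ (L : (Fin (nW cd) → ℝ) →L[ℝ] (Fin (nW cd) → ℝ)) (K : Ker),
      HasFDerivWithinAt (fun yv => flowSel (Qw cd) yv (cd.h j s)) L
        (Icc (toVec cd (bx.hlo 2 j s)) (toVec cd (bx.hhi 2 j s))) (toVec cd z) ∧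
      (∀ (vv : Fin (nW cd) → ℝ) (r : ℝ), 0 ≤ r → (∀ c, |vv c| ≤ r * wW cd j c) →
        L vv ∈ Icc (r • toVec cd (bx.loV j s)) (r • toVec cd (bx.hiV j s))) ∧
      KerMem cd K (bx.Mlo j s) (bx.Mhi j s) ∧
      ∀ (vv : Fin (nW cd) → ℝ) i' k' (hk' : -cd.Kb ≤ k' ∧ k' ≤ cd.Ka),
        L vv (eW cd (i', ⟨k', Finset.mem_Icc.2 hk'⟩)) = kapp cd K (ofVec cd vv) i' k' := by
  have hh : cd.h j s ∈ Icc 0 (cd.h j s) := ⟨((gridV hC hj).2.1 _ hs).1.le, le_rfl⟩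
  obtain ⟨L, hL, hdir, hcol⟩ := exists_fderiv_directional_of_core hSN hC hj hs hz hh
  obtain ⟨-, -, -, -, -, -, -, -, -, -, -, hM⟩ := (hC j hj).2.2.2 s hs
  classical
  refine ⟨L, fun i' k' i k => if hk' : -cd.Kb ≤ k' ∧ k' ≤ cd.Ka then
      (if hk : -cd.Kb ≤ k ∧ k ≤ cd.Ka then
        L (Pi.single (eW cd (i, ⟨k, Finset.mem_Icc.2 hk⟩)) 1) (eW cd (i', ⟨k', Finset.mem_Icc.2 hk'⟩)) else 0) else 0,
    hL, hdir, ?_, ?_⟩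
  · -- kernel in `[Mlo, Mhi]`: column Taylor model + clause (M) at `z ∈ H²`
    intro i' k' hk1' hk2' i k hk1 hk2
    have hk' : -cd.Kb ≤ k' ∧ k' ≤ cd.Ka := ⟨hk1', hk2'⟩
    have hk : -cd.Kb ≤ k ∧ k ≤ cd.Ka := ⟨hk1, hk2⟩
    simp only [dif_pos hk', dif_pos hk]
    set c : Fin (nW cd) := eW cd (i, ⟨k, Finset.mem_Icc.2 hk⟩) with hc
    set c' : Fin (nW cd) := eW cd (i', ⟨k', Finset.mem_Icc.2 hk'⟩) with hc'
    have h1 := hcol c c'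
    have h2 := hM z hz i k hk1 hk2 i' k' hk1' hk2'
    have e1 : ∀ n, varJet cd.Qb z (basisSt i k) n i' k' = varJet (Qw cd) (toVec cd z) (Pi.single c 1) n c' := by
      intro n
      have h3 := congrFun (toVec_varJet (cd := cd) z (basisSt i k) n) c'
      rw [toVec_basisSt (cd := cd) i hk] at h3
      simp only [toVec, hc', modeOf, shellOf, Equiv.symm_apply_apply] at h3
      rw [← hc'] at h3
      simpa [hc] using h3
    have e3 : cd.ω j k = wW cd j c := by simp [wW, hc, shellOf]
    have e4 : bx.JU j s i' k' = toVec cd (bx.JU j s) c' := by simp [toVec, hc', modeOf, shellOf]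
    rw [e3, e4] at h2
    simp only [e1] at h2
    have h4 := abs_le.1 h1
    constructor <;> linarith [h2.1, h2.2, h4.1, h4.2]
  · -- the kernel represents `L` on the window
    intro vv i' k' hk'
    rw [clm_apply_eq_sum_single, kapp, if_pos hk']
    refine Finset.sum_congr rfl fun c _ => ?_
    simp only [dif_pos hk', dif_pos (shellOf_mem cd c), toVec_ofVec, eW_modeOf_shellOf]
    ring

/-! ### Directions along κ-restart chains -/

section Deriv


/-- **Directions through the nodes.** For restarts `z, z′` (both `κ`-close to `φ j q (t)`, `t ∈ [Tn a, Tn (a+1)]`,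
`|z − z′| ≤ d·ω`) and every later node `b = a+1+n ≤ S`: the curve `σ ↦ toVec (φ(z_σ)(Tn b − t))`,
`z_σ = z′ + σ(z − z′)`, is differentiable within `[0,1]`, and its derivative is (on the window) a chain of real
kernels `A s' ∈ [Mlo s', Mhi s']`, `a+1 ≤ s' < b`, applied to an entry direction of size `≤ L1_a·d·ω`. [folklore] -/
theorem restart_dirNodes (hSN : cd.StageNumerics) (hC : ChainVCore cd bx) (hF : IsFlowPackageV cd bx φ) (hRO : ReadoutsV cd bx rd ro) {j : ℕ} (hj : j ≤ cd.N₀) (hwin : -cd.Kb ≤ cd.Ka) {q : Fin 4 → ℤ → ℝ} (hq : SolvesOn cd φ j q (cd.Tn j (cd.S j))) (hqN : ∀ s, s ≤ cd.S j → InBox cd (bx.hlo 1 j s) (bx.hhi 1 j s) (stAt φ j q (cd.Tn j s))) {a : ℕ} (ha : a < cd.S j) {t : ℝ} (ht : t ∈ Icc (cd.Tn j a) (cd.Tn j (a + 1)))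
    {z z' : Fin 4 → ℤ → ℝ} (hz : cd.InBall j (z - stAt φ j q t) (cd.κ j))
    (hz' : cd.InBall j (z' - stAt φ j q t) (cd.κ j)) {dd : ℝ} (hzz' : cd.InBall j (z - z') dd) :
    ∀ n : ℕ, a + 1 + n ≤ cd.S j → ∀ σ ∈ Icc (0:ℝ) 1, ∃ w : Fin (nW cd) → ℝ,
      HasDerivWithinAt (fun σ' : ℝ => toVec cd (stAt φ j (z' + σ' • (z - z')) (cd.Tn j (a + 1 + n) - t)))
        w (Icc 0 1) σ ∧
      ∃ A : ℕ → Ker, (∀ s', a + 1 ≤ s' → s' < a + 1 + n → KerMem cd (A s') (bx.Mlo j s') (bx.Mhi j s')) ∧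
        ∃ w₁ : Fin 4 → ℤ → ℝ, cd.InBall j w₁ (cd.L1 j a * dd) ∧
          ∀ i k, -cd.Kb ≤ k → k ≤ cd.Ka → ofVec cd w i k = kiter cd A (a + 1) n w₁ i k := by
  have hU := isUniqueFlow_of_packageV hF
  have hTa1 := ((gridV hC hj).2.1 _ ha).2
  -- every point of the segment is a restart
  have hzσ : ∀ σ ∈ Icc (0:ℝ) 1, cd.InBall j (z' + σ • (z - z') - stAt φ j q t) (cd.κ j) :=
    fun σ hσ => inBall_segment hz hz' hσ
  intro n
  induction n with
  | zero =>
    intro hn σ hσ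
    simp only [Nat.add_zero] at hn ⊢
    -- (F4′) on the first partial sub-step, at its end
    obtain ⟨hw, hwB⟩ := polyNode_solves_inBox hC hF hj hq ha (hqN a ha.le)
    have hu₀ : t - cd.Tn j a ∈ Icc 0 (cd.h j a) := ⟨by linarith [ht.1], by linarith [ht.2]⟩
    have hqt : stAt φ j q t = stAt φ j (stAt φ j q (cd.Tn j a)) (t - cd.Tn j a) :=
      (polyNode_shift hC hF hj hq ha.le).2 t ⟨ht.1, ht.2.trans ((gridV hC hj).2.2.1 _ le_rfl _ (Nat.succ_le_of_lt ha))⟩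
    have hzw := hz; have hz'w := hz'
    rw [hqt] at hzw hz'w
    obtain ⟨-, hF4, -⟩ := ((hF.2 j hj).2.2 a ha).2
    have ht' : cd.Tn j (a + 1) - t ∈ Icc 0 (cd.h j a - (t - cd.Tn j a)) :=
      ⟨by linarith [ht.2], by rw [hTa1]; linarith⟩
    have hex : ∀ i k, -cd.Kb ≤ k → k ≤ cd.Ka → ∃ ψ : ℝ → ℝ, ∀ σ ∈ Icc (0:ℝ) 1,
        HasDerivWithinAt (fun σ' : ℝ => φ j (z' + σ' • (z - z')) i k (cd.Tn j (a + 1) - t)) (ψ σ) (Icc 0 1) σ ∧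
        |ψ σ| ≤ cd.L1 j a * dd * cd.ω j k :=
      fun i k hk1 hk2 => hF4 _ _ hu₀ hw hwB z z' dd hzw hz'w hzz' i k hk1 hk2 _ ht'
    choose ψ hψ using hex
    refine ⟨fun c => ψ (modeOf cd c) (shellOf cd c) (shellOf_mem cd c).1 (shellOf_mem cd c).2 σ, ?_,
      fun _ => fun _ _ _ _ => 0, fun s' h1 h2 => absurd h2 (not_lt.2 h1),
      ofVec cd (fun c => ψ (modeOf cd c) (shellOf cd c) (shellOf_mem cd c).1 (shellOf_mem cd c).2 σ), ?_,
      fun i k _ _ => rfl⟩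
    · exact hasDerivWithinAt_pi.2 fun c =>
        (hψ (modeOf cd c) (shellOf cd c) (shellOf_mem cd c).1 (shellOf_mem cd c).2 σ hσ).1
    · refine (inBall_ofVec_iff cd j _ _).2 fun c => ?_
      have h1 := (hψ (modeOf cd c) (shellOf cd c) (shellOf_mem cd c).1 (shellOf_mem cd c).2 σ hσ).2
      simpa [wW, mul_assoc] using h1
  | succ n IH =>
    intro hn σ hσ
    have eb : a + 1 + (n + 1) = a + 1 + n + 1 := rfl
    rw [eb] at hn ⊢
    have hb : a + 1 + n < cd.S j := Nat.lt_of_succ_le hn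
    have hTb := ((gridV hC hj).2.1 _ hb).2
    obtain ⟨w, hw, A, hA, w₁, hw₁, heq⟩ := IH hb.le σ hσ
    -- node facts of every restart of the segment (part 1)
    have hN := fun σ' (hσ' : σ' ∈ Icc (0:ℝ) 1) =>
      restart_nodes hSN hC hF hRO hj hwin hq hqN ha ht (hzσ σ' hσ') n hb.le
    have hN' := fun σ' (hσ' : σ' ∈ Icc (0:ℝ) 1) =>
      restart_nodes hSN hC hF hRO hj hwin hq hqN ha ht (hzσ σ' hσ') (n + 1) hn
    have ht0 : 0 ≤ cd.Tn j (a + 1 + n) - t := by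
      have := (gridV hC hj).2.2.1 _ hb.le _ (Nat.le_add_right (a + 1) n); linarith [ht.2]
    -- the next node state is the sub-step flow of the current one (every σ' ∈ [0,1])
    have hshift : ∀ σ' ∈ Icc (0:ℝ) 1,
        toVec cd (stAt φ j (z' + σ' • (z - z')) (cd.Tn j (a + 1 + n + 1) - t)) =
          flowSel (Qw cd) (toVec cd (stAt φ j (z' + σ' • (z - z')) (cd.Tn j (a + 1 + n) - t))) (cd.h j (a + 1 + n)) := by
      intro σ' hσ'
      have hsol := (hN' σ' hσ').1
      rw [eb] at hsol
      have h1 := (stAt_shiftU hU hj hsol (t := cd.Tn j (a + 1 + n) - t)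
        ⟨ht0, by rw [hTb]; linarith [((gridV hC hj).2.1 _ hb).1]⟩).2 (cd.Tn j (a + 1 + n + 1) - t)
        ⟨by rw [hTb]; linarith [((gridV hC hj).2.1 _ hb).1], le_rfl⟩
      rw [h1, ← toVec_stAt_eq_flowSel hF]
      congr 2; rw [hTb]; ring
    -- (F9) kernel at the current node state, chain rule
    obtain ⟨L, K, hL, -, hKM, hLK⟩ := exists_stepKer_of_core hSN hC hj hb (hN σ hσ).2.2.2.2
    have hmaps : MapsTo (fun σ' : ℝ => toVec cd (stAt φ j (z' + σ' • (z - z')) (cd.Tn j (a + 1 + n) - t)))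
        (Icc (0:ℝ) 1) (Icc (toVec cd (bx.hlo 2 j (a + 1 + n))) (toVec cd (bx.hhi 2 j (a + 1 + n)))) :=
      fun σ' hσ' => toVec_mem_Icc_of_bounds (cd := cd) (hN σ' hσ').2.2.2.2
    have hcomp := hL.comp_hasDerivWithinAt σ hw hmaps
    have hder : HasDerivWithinAt
        (fun σ' : ℝ => toVec cd (stAt φ j (z' + σ' • (z - z')) (cd.Tn j (a + 1 + n + 1) - t))) (L w) (Icc 0 1) σ :=
      hcomp.congr_of_mem (fun σ' hσ' => by simpa [Function.comp] using hshift σ' hσ') hσ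
    -- the extended kernel chain
    classical
    obtain ⟨A', hA'⟩ : ∃ A' : ℕ → Ker, ∀ s, A' s = if s = a + 1 + n then K else A s :=
      ⟨fun s => if s = a + 1 + n then K else A s, fun _ => rfl⟩
    have hA'M : ∀ s', a + 1 ≤ s' → s' < a + 1 + n + 1 → KerMem cd (A' s') (bx.Mlo j s') (bx.Mhi j s') := by
      intro s' h1 h2
      rcases Nat.lt_succ_iff_lt_or_eq.1 h2 with hlt | heq'
      · rw [hA', if_neg (Nat.ne_of_lt hlt)]; exact hA s' h1 hlt
      · rw [hA', heq', if_pos rfl]; exact hKM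
    refine ⟨L w, hder, A', hA'M, w₁, hw₁, fun i' k' hk1' hk2' => ?_⟩
    have hk' : -cd.Kb ≤ k' ∧ k' ≤ cd.Ka := ⟨hk1', hk2'⟩
    have h2 : kiter cd A' (a + 1) (n + 1) w₁ = kapp cd (A' (a + 1 + n)) (kiter cd A' (a + 1) n w₁) := rfl
    have h3 : A' (a + 1 + n) = K := by rw [hA', if_pos rfl]
    have h4 : kiter cd A' (a + 1) n w₁ = kiter cd A (a + 1) n w₁ :=
      (kiter_congr (fun m hm => by rw [hA', if_neg (by omega)]) w₁).symm
    rw [ofVec_apply_of_mem cd _ i' hk', hLK w i' k' hk', h2, h3, h4, kapp_congr K heq]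

/-- **SEGMENT DERIVATIVES (K1b-DR's flow-Lipschitz clause along the κ-tube).** For restarts `z, z′` both
`κ_j·ω`-close to `φ j q (t)` (`t ∈ [0, Tn S]`) with `|z − z′| ≤ d·ω` and every `t′ ∈ [0, Tn S − t]`, each window
component of `σ ↦ φ j (z′ + σ(z − z′)) (t′)` is differentiable within `[0,1]` with derivative bounded by
`Λ_j·d·ω_k`. [folklore] -/
theorem restart_segDeriv (hSN : cd.StageNumerics) (hC : ChainVCore cd bx) (hF : IsFlowPackageV cd bx φ) (hRO : ReadoutsV cd bx rd ro) {j : ℕ} (hj : j ≤ cd.N₀) (hwin : -cd.Kb ≤ cd.Ka) {q : Fin 4 → ℤ → ℝ} (hq : SolvesOn cd φ j q (cd.Tn j (cd.S j))) (hqN : ∀ s, s ≤ cd.S j → InBox cd (bx.hlo 1 j s) (bx.hhi 1 j s) (stAt φ j q (cd.Tn j s))) {t : ℝ} (ht : t ∈ Icc 0 (cd.Tn j (cd.S j)))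
    {z z' : Fin 4 → ℤ → ℝ} (hz : cd.InBall j (z - stAt φ j q t) (cd.κ j))
    (hz' : cd.InBall j (z' - stAt φ j q t) (cd.κ j)) {dd : ℝ} (hzz' : cd.InBall j (z - z') dd) :
    ∀ i k, -cd.Kb ≤ k → k ≤ cd.Ka → ∀ t' ∈ Icc 0 (cd.Tn j (cd.S j) - t), ∃ ψ : ℝ → ℝ, ∀ σ ∈ Icc (0:ℝ) 1,
      HasDerivWithinAt (fun σ' : ℝ => φ j (z' + σ' • (z - z')) i k t') (ψ σ) (Icc 0 1) σ ∧
      |ψ σ| ≤ cd.Λ j * dd * cd.ω j k := by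
  have hU := isUniqueFlow_of_packageV hF
  have hω : ∀ k, 0 < cd.ω j k := (hSN.1 j hj).2.2.2.2.2.2.1
  have hκ : 0 ≤ cd.κ j := le_of_lt (hSN.1 j hj).2.2.2.1
  obtain ⟨-, -, -, -, -, -, hR2, hR3, hR3b, -⟩ := hRO j hj
  have hS : 0 < cd.S j := (hC j hj).1
  have h0 : cd.Tn j 0 ≤ t := by rw [(hC j hj).2.1]; exact ht.1
  obtain ⟨a, -, ha, hta, hta1⟩ := G3.exists_substep (cd := cd) (j := j) hS h0 ht.2
  have hTa1 := ((gridV hC hj).2.1 _ ha).2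
  -- `dd ≥ 0` (nonempty window)
  have hdd : 0 ≤ dd := by
    have h1 := hzz' 0 cd.Ka hwin le_rfl
    exact nonneg_of_mul_nonneg_left ((abs_nonneg _).trans h1) (hω _)
  have hzσ : ∀ σ ∈ Icc (0:ℝ) 1, cd.InBall j (z' + σ • (z - z') - stAt φ j q t) (cd.κ j) :=
    fun σ hσ => inBall_segment hz hz' hσ
  intro i k hk1 hk2 t' ht'
  have hk : -cd.Kb ≤ k ∧ k ≤ cd.Ka := ⟨hk1, hk2⟩
  -- it suffices to produce the derivative value pointwise in `σ`
  suffices hpt : ∀ σ ∈ Icc (0:ℝ) 1, ∃ y : ℝ,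
      HasDerivWithinAt (fun σ' : ℝ => φ j (z' + σ' • (z - z')) i k t') y (Icc 0 1) σ ∧
        |y| ≤ cd.Λ j * dd * cd.ω j k by
    classical
    refine ⟨fun σ => if hσ : σ ∈ Icc (0:ℝ) 1 then Classical.choose (hpt σ hσ) else 0, fun σ hσ => ?_⟩
    simp only [dif_pos hσ]
    exact Classical.choose_spec (hpt σ hσ)
  intro σ hσ
  by_cases hfirst : t' ≤ cd.Tn j (a + 1) - t
  · -- inside the first partial sub-step: (F4′) with `L1_a ≤ Λ`
    obtain ⟨hw, hwB⟩ := polyNode_solves_inBox hC hF hj hq ha (hqN a ha.le)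
    have hu₀ : t - cd.Tn j a ∈ Icc 0 (cd.h j a) := ⟨by linarith, by linarith⟩
    have hqt : stAt φ j q t = stAt φ j (stAt φ j q (cd.Tn j a)) (t - cd.Tn j a) :=
      (polyNode_shift hC hF hj hq ha.le).2 t ⟨hta, ht.2⟩
    have hzw := hz; have hz'w := hz'
    rw [hqt] at hzw hz'w
    obtain ⟨-, hF4, -⟩ := ((hF.2 j hj).2.2 a ha).2
    have ht'' : t' ∈ Icc 0 (cd.h j a - (t - cd.Tn j a)) := ⟨ht'.1, by rw [hTa1] at hfirst; linarith⟩
    obtain ⟨ψ, hψ⟩ := hF4 _ _ hu₀ hw hwB z z' dd hzw hz'w hzz' i k hk1 hk2 t' ht''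
    refine ⟨ψ σ, (hψ σ hσ).1, (hψ σ hσ).2.trans ?_⟩
    have h1 := hR3b a ha
    have : 0 ≤ dd * cd.ω j k := mul_nonneg hdd (hω k).le
    nlinarith
  · -- beyond the first node: locate `t + t'` in a sub-step `b ≥ a+1`, `b < S`
    have hlt := lt_of_not_ge hfirst
    have ha1 : a + 1 < cd.S j := by
      by_contra hge
      have hS' : cd.S j = a + 1 := le_antisymm (not_lt.1 hge) (Nat.succ_le_of_lt ha)
      rw [hS'] at ht'
      linarith [ht'.2]
    obtain ⟨b, hab, hb, htb, htb1⟩ := G3.exists_substep (cd := cd) (j := j) (t := t + t') ha1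
      (by linarith) (by linarith [ht'.2])
    obtain ⟨n, rfl⟩ : ∃ n, b = a + 1 + n := ⟨b - (a + 1), (Nat.add_sub_cancel' hab).symm⟩
    have hTb := ((gridV hC hj).2.1 _ hb).2
    have hu' : t + t' - cd.Tn j (a + 1 + n) ∈ Icc 0 (cd.h j (a + 1 + n)) :=
      ⟨by linarith, by rw [hTb] at htb1; linarith⟩
    -- direction at node b and its size
    obtain ⟨w, hw, A, hA, w₁, hw₁, heq⟩ :=
      restart_dirNodes hSN hC hF hRO hj hwin hq hqN ha ⟨hta, hta1⟩ hz hz' hzz' n hb.le σ hσ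
    have hL1a : 0 ≤ cd.L1 j a := (one_le_L1V hC hj hω hwin ha).2
    have hwB : cd.InBall j (ofVec cd w) (ro.G j (a + 1) (a + 1 + n) * (cd.L1 j a * dd)) := by
      have h2 := hR2 (a + 1) (a + 1 + n) (Nat.le_add_right _ _) hb.le A hA w₁ _ (mul_nonneg hL1a hdd) hw₁
      rw [Nat.add_sub_cancel_left] at h2
      exact inBall_of_window_eq heq h2
    set r : ℝ := ro.G j (a + 1) (a + 1 + n) * (cd.L1 j a * dd) with hr
    have hr0 : 0 ≤ r := by
      have h1 := hwB 0 cd.Ka hwin le_rfl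
      exact nonneg_of_mul_nonneg_left ((abs_nonneg _).trans h1) (hω _)
    have hwabs : ∀ c, |w c| ≤ r * wW cd j c := (inBall_ofVec_iff cd j _ _).1 hwB
    -- node facts of the segment restarts at node b and b+1
    have hN := fun σ' (hσ' : σ' ∈ Icc (0:ℝ) 1) =>
      restart_nodes hSN hC hF hRO hj hwin hq hqN ha ⟨hta, hta1⟩ (hzσ σ' hσ') n hb.le
    have hN' := fun σ' (hσ' : σ' ∈ Icc (0:ℝ) 1) =>
      restart_nodes hSN hC hF hRO hj hwin hq hqN ha ⟨hta, hta1⟩ (hzσ σ' hσ') (n + 1) hb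
    have ht0 : 0 ≤ cd.Tn j (a + 1 + n) - t := by
      have := (gridV hC hj).2.2.1 _ hb.le _ (Nat.le_add_right (a + 1) n); linarith
    have hshift : ∀ σ' ∈ Icc (0:ℝ) 1,
        toVec cd (stAt φ j (z' + σ' • (z - z')) t') =
          flowSel (Qw cd) (toVec cd (stAt φ j (z' + σ' • (z - z')) (cd.Tn j (a + 1 + n) - t)))
            (t + t' - cd.Tn j (a + 1 + n)) := by
      intro σ' hσ'
      have eb : a + 1 + (n + 1) = a + 1 + n + 1 := rfl
      have hsol := (hN' σ' hσ').1
      rw [eb] at hsol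
      have h1 := (stAt_shiftU hU hj hsol (t := cd.Tn j (a + 1 + n) - t)
        ⟨ht0, by rw [hTb]; linarith [((gridV hC hj).2.1 _ hb).1]⟩).2 t' ⟨by linarith, by rw [hTb]; linarith⟩
      rw [h1, ← toVec_stAt_eq_flowSel hF]
      congr 2; ring
    -- (F9) at the node state, in-step time `u'`, DIRECTIONAL
    obtain ⟨L', hL', hdir', -⟩ := exists_fderiv_directional_of_core hSN hC hj hb (hN σ hσ).2.2.2.2 hu'
    have hmaps : MapsTo (fun σ' : ℝ => toVec cd (stAt φ j (z' + σ' • (z - z')) (cd.Tn j (a + 1 + n) - t)))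
        (Icc (0:ℝ) 1) (Icc (toVec cd (bx.hlo 2 j (a + 1 + n))) (toVec cd (bx.hhi 2 j (a + 1 + n)))) :=
      fun σ' hσ' => toVec_mem_Icc_of_bounds (cd := cd) (hN σ' hσ').2.2.2.2
    have hcomp := hL'.comp_hasDerivWithinAt σ hw hmaps
    have hvec : HasDerivWithinAt (fun σ' : ℝ => toVec cd (stAt φ j (z' + σ' • (z - z')) t')) (L' w) (Icc 0 1) σ :=
      hcomp.congr_of_mem (fun σ' hσ' => by simpa [Function.comp] using hshift σ' hσ') hσ
    have hcompo := (hasDerivWithinAt_pi.1 hvec) (eW cd (i, ⟨k, Finset.mem_Icc.2 hk⟩))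
    have efun : (fun σ' : ℝ => toVec cd (stAt φ j (z' + σ' • (z - z')) t') (eW cd (i, ⟨k, Finset.mem_Icc.2 hk⟩))) =
        fun σ' : ℝ => φ j (z' + σ' • (z - z')) i k t' := by
      funext σ'; simp [toVec, stAt, modeOf, shellOf]
    rw [efun] at hcompo
    refine ⟨L' w (eW cd (i, ⟨k, Finset.mem_Icc.2 hk⟩)), hcompo, ?_⟩
    -- the bound: `L' w ∈ r·[loV, hiV]`, rows `≤ L1_b·ω`, `L1_a·G·L1_b ≤ Λ`
    have hmem := hdir' w r hr0 hwabs
    obtain ⟨-, -, -, -, -, -, -, -, -, hVrow, -⟩ := (hC j hj).2.2.2 _ hb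
    have hrow := hVrow i k hk1 hk2
    have e1 : (r • toVec cd (bx.loV j (a + 1 + n))) (eW cd (i, ⟨k, Finset.mem_Icc.2 hk⟩)) = r * bx.loV j (a + 1 + n) i k := by
      simp [toVec, modeOf, shellOf]
    have e2 : (r • toVec cd (bx.hiV j (a + 1 + n))) (eW cd (i, ⟨k, Finset.mem_Icc.2 hk⟩)) = r * bx.hiV j (a + 1 + n) i k := by
      simp [toVec, modeOf, shellOf]
    have hlo := hmem.1 (eW cd (i, ⟨k, Finset.mem_Icc.2 hk⟩))
    have hhi := hmem.2 (eW cd (i, ⟨k, Finset.mem_Icc.2 hk⟩))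
    rw [e1] at hlo
    rw [e2] at hhi
    have hl' : |bx.loV j (a + 1 + n) i k| ≤ cd.L1 j (a + 1 + n) * cd.ω j k := (le_max_left _ _).trans hrow
    have hh' : |bx.hiV j (a + 1 + n) i k| ≤ cd.L1 j (a + 1 + n) * cd.ω j k := (le_max_right _ _).trans hrow
    have hΛ := (hR3 a (a + 1 + n) ha (Nat.le_add_right _ _) hb.le).2 hb
    have hbound : r * (cd.L1 j (a + 1 + n) * cd.ω j k) ≤ cd.Λ j * dd * cd.ω j k := by
      rw [hr]
      have : 0 ≤ dd * cd.ω j k := mul_nonneg hdd (hω k).le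
      nlinarith
    rw [abs_le]
    constructor
    · nlinarith [neg_abs_le (bx.loV j (a + 1 + n) i k), hlo, hl', hr0]
    · nlinarith [le_abs_self (bx.hiV j (a + 1 + n) i k), hhi, hh', hr0]

end Deriv

/-! ### K1b-DR's κ-tube and flow-Lipschitz blocks -/

section Blocks


/-- **`KBlockTube ∧ KBlockLip` from the v3 certificate** (given the G1-v node invariant and `0 ≤ τ ≤ Tn S`): the
κ-tube ODE clause and the flow-Lipschitz segment-derivative clause of K1b-DR. [folklore] -/
theorem kBlockTubeLip_ofV (hSN : cd.StageNumerics) (hC : ChainVCore cd bx) (hF : IsFlowPackageV cd bx φ) (hRO : ReadoutsV cd bx rd ro) (hwin : -cd.Kb ≤ cd.Ka) {τ : Cross} (hPN : ∀ j, j ≤ cd.N₀ → ∀ q, InPoly cd j q → SolvesOn cd φ j q (cd.Tn j (cd.S j)) ∧ ∀ s, s ≤ cd.S j → InBox cd (bx.hlo 1 j s) (bx.hhi 1 j s) (stAt φ j q (cd.Tn j s))) (hτ : ∀ j, j ≤ cd.N₀ → ∀ q, InPoly cd j q → 0 ≤ τ j q ∧ τ j q ≤ cd.Tn j (cd.S j))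 : KBlockTube cd φ τ ∧ KBlockLip cd φ τ := by
  constructor
  · intro j hj q hq t ht z hz i k hk1 hk2
    obtain ⟨hqS, hqN⟩ := hPN j hj q hq
    have hτq := hτ j hj q hq
    have ht' : t ∈ Icc 0 (cd.Tn j (cd.S j)) := ⟨ht.1, ht.2.trans hτq.2⟩
    have hzB : cd.InBall j (z - stAt φ j q t) (cd.κ j) := fun i k hk1 hk2 => hz i k hk1 hk2
    obtain ⟨hsol, hbd⟩ := restart_tube hSN hC hF hRO hj hwin hqS hqN ht' hzB
    have hle : τ j q - t ≤ cd.Tn j (cd.S j) - t := by linarith [hτq.2]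
    have hsol' := solvesOn_of_le hsol hle
    exact ⟨(hsol' i k hk1 hk2).1, fun t' ht'' =>
      ⟨(hsol' i k hk1 hk2).2 t' ht'', hbd t' ⟨ht''.1, ht''.2.trans hle⟩ i k hk1 hk2⟩⟩
  · intro j hj q hq t ht z z' d u hzz _ htu i k hk1 hk2 t' ht'
    obtain ⟨hqS, hqN⟩ := hPN j hj q hq
    have hτq := hτ j hj q hq
    have htS : t ∈ Icc 0 (cd.Tn j (cd.S j)) := ⟨ht.1, ht.2.trans hτq.2⟩
    have hz : cd.InBall j (z - stAt φ j q t) (cd.κ j) := fun i k hk1 hk2 => (hzz i k hk1 hk2).1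
    have hz' : cd.InBall j (z' - stAt φ j q t) (cd.κ j) := fun i k hk1 hk2 => (hzz i k hk1 hk2).2.1
    have hd : cd.InBall j (z - z') d := fun i k hk1 hk2 => (hzz i k hk1 hk2).2.2
    exact restart_segDeriv hSN hC hF hRO hj hwin hqS hqN htS hz hz' hd i k hk1 hk2 t'
      ⟨ht'.1, by linarith [ht'.2, hτq.2, htu]⟩

end Blocks

end Summit.NavierStokesRegularity.NavierStokesRegularity.Theorems.TaylorModelV

end
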